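import Summits.Ventures.PercRepro.RankLevelSetRuleQCellFiveFalse

/-!
# PercRepro — RULE Q FAILS ON EVERY CELL FAMILY `k ≥ 5`: `¬ RhatCell q k` FOR EVERY `k ≥ 5` AND EVERY `q ≥ 4^(k+3) + 2`
(night-1, gen 16; dossier §27.7)

The uniform version of RankLevelSetRuleQCellFiveFalse: on the member slice `u = q − m = 2` of the cell `(q+k, q)`,
* `R̂(m+2, k, m) ≤ (k+2)·S₁ + C(k+2, 2)·S₂ + (Σ_{3≤j<k} C(k+2, j)/C(j, 2))·T` — the truncated `m̂(q, m; a, j)` keeps its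
  term `C(j, 2)·C(q+a, a+2)` for every `j ≥ 2` (`mhat_ge_choose_two`), and `Σ_{3≤j<k} C(k+2, j)/C(j, 2) ≤ 2^{k+2}/3`;
* the three slice sums are explicit through the exact half rows (`S₁ < 1/2`, `S₂ ≤ (1+2X)/(4m)`, `T ≤ (2+X)/(4m)`,
  `X = 4^m/C(2m, m)`, `X² ≤ 4m` by the Wallis upper bound), while `Φ(q+k, q) ≥ k − 1` termwise;
* for `m ≥ 4^{k+3}`: `X ≤ m/2^{k+2}` and the bound is `< (k+2)/2 + 1/2 ≤ k − 1`.
* **`not_rhatCell_of_five_le`** — `¬ RhatCell q k` for every `k ≥ 5` and every `q ≥ 4^{k+3} + 2`. Together with p4's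
  `rhatCell_two` / `rhatCell_three` / `rhatCell_four`, (R̂) holds on every cell of a family `k` IF AND ONLY IF `k ≤ 4`:
  Rule Q's equal split is exactly the `k ≤ 4` mechanism of C-044's UP form at the tight layer.
The threshold `4^{k+3}` is crude (the exact first failures are `q = 672, 264, 141` at `k = 5, 6, 7`, mining/night-1/g16/);
twin: kuni.py (the chain exact for `k ≤ 8`, `m ≤ 13`). Axioms: standard.
-/

namespace PercRepro

open Finset

/-! ### §1 The truncated `m̂` at `u = 2` for every `j ≥ 2`, and `Φ ≥ k − 1` -/

/-- On the slice `u = 2`, `m̂(q, m; a, j) ≥ C(j, 2)·C(q+a, a+2)` for every `j ≥ 2` (one term of `mhat_eq`). -/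
lemma mhat_ge_choose_two (m a j : ℕ) (hj : 2 ≤ j) :
    j.choose 2 * (m + 2 + a).choose (a + 2) ≤ mhat (m + 2) m a j := by
  rw [mhat_eq, show m + 2 - m = 2 by omega, show min j 2 = 2 by omega]
  simp only [Finset.sum_range_succ, Finset.sum_range_zero, zero_add]
  omega

/-- `Φ(q+k, q) ≥ k − 1` for `k ≥ 1`: every term `C(q+k, i+1)/C(q+i+1, q)` is at least `1`. -/
lemma phiK_ge_sub_one (q k : ℕ) (hk : 1 ≤ k) : (k : ℚ) - 1 ≤ phiK (q + k) q := by
  rw [phiK_eq_sum_range q k hk]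
  have h : ∀ i ∈ Finset.range (k - 1), (1 : ℚ) ≤ ((q + k).choose (i + 1) : ℚ) / ((q + i + 1).choose q : ℚ) := by
    intro i hi
    rw [Finset.mem_range] at hi
    have hpos : (0 : ℚ) < (q + i + 1).choose q := by exact_mod_cast Nat.choose_pos (by omega)
    rw [le_div_iff₀ hpos, one_mul]
    have h1 : (q + i + 1).choose q = (q + i + 1).choose (i + 1) := by
      rw [show q + i + 1 = q + (i + 1) by ring, Nat.choose_symm_add]
    rw [h1]
    exact_mod_cast Nat.choose_le_choose (i + 1) (by omega : q + i + 1 ≤ q + k)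
  calc (k : ℚ) - 1 = ∑ i ∈ Finset.range (k - 1), (1 : ℚ) := by
        rw [Finset.sum_const, Finset.card_range, nsmul_eq_mul, mul_one, Nat.cast_sub hk]; push_cast; ring
    _ ≤ _ := Finset.sum_le_sum h

/-- `Σ_{3 ≤ j < k} C(k+2, j)/C(j, 2) ≤ 2^{k+2}/3` (each `C(j, 2) ≥ 3`, and the row sum). -/
lemma sum_choose_div_choose_two_le (k : ℕ) (hk : 3 ≤ k) :
    ∑ u ∈ Finset.range (k - 3), ((k + 2).choose (u + 3) : ℚ) / ((u + 3).choose 2 : ℚ) ≤ (2 : ℚ) ^ (k + 2) / 3 := by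
  have hterm : ∀ u ∈ Finset.range (k - 3),
      ((k + 2).choose (u + 3) : ℚ) / ((u + 3).choose 2 : ℚ) ≤ ((k + 2).choose (u + 3) : ℚ) / 3 := by
    intro u _
    have h3 : (3 : ℕ) ≤ (u + 3).choose 2 := by
      calc (3 : ℕ) = (3 : ℕ).choose 2 := by decide
        _ ≤ (u + 3).choose 2 := Nat.choose_le_choose 2 (by omega)
    have h3' : (3 : ℚ) ≤ ((u + 3).choose 2 : ℚ) := by exact_mod_cast h3
    exact div_le_div_of_nonneg_left (by positivity) (by norm_num) h3'
  have hrow : ∑ u ∈ Finset.range (k - 3), ((k + 2).choose (u + 3) : ℚ) ≤ (2 : ℚ) ^ (k + 2) := by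
    have hsplit := Finset.sum_range_add (fun i => (k + 2).choose i) 3 (k - 3)
    rw [show 3 + (k - 3) = k by omega] at hsplit
    have hsub : ∑ i ∈ Finset.range k, (k + 2).choose i ≤ ∑ i ∈ Finset.range (k + 2 + 1), (k + 2).choose i :=
      Finset.sum_le_sum_of_subset_of_nonneg (Finset.range_mono (by omega : k ≤ k + 2 + 1))
        (fun _ _ _ => Nat.zero_le _)
    rw [Nat.sum_range_choose] at hsub
    have h' : ∑ u ∈ Finset.range (k - 3), (k + 2).choose (u + 3) ≤ 2 ^ (k + 2) := by
      have hre : ∑ u ∈ Finset.range (k - 3), (k + 2).choose (3 + u)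
          = ∑ u ∈ Finset.range (k - 3), (k + 2).choose (u + 3) := by
        refine Finset.sum_congr rfl (fun u _ => by rw [Nat.add_comm 3 u])
      calc ∑ u ∈ Finset.range (k - 3), (k + 2).choose (u + 3)
          = ∑ u ∈ Finset.range (k - 3), (k + 2).choose (3 + u) := hre.symm
        _ ≤ ∑ i ∈ Finset.range k, (k + 2).choose i := by rw [hsplit]; exact Nat.le_add_left _ _
        _ ≤ 2 ^ (k + 2) := hsub
    exact_mod_cast h'
  calc ∑ u ∈ Finset.range (k - 3), ((k + 2).choose (u + 3) : ℚ) / ((u + 3).choose 2 : ℚ)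
      ≤ ∑ u ∈ Finset.range (k - 3), ((k + 2).choose (u + 3) : ℚ) / 3 := Finset.sum_le_sum hterm
    _ = (∑ u ∈ Finset.range (k - 3), ((k + 2).choose (u + 3) : ℚ)) / 3 := by rw [Finset.sum_div]
    _ ≤ (2 : ℚ) ^ (k + 2) / 3 := by gcongr

/-! ### §2 The uniform bound on `R̂(m+2, k, m)` -/

/-- **`R̂(m+2, k, m) ≤ (k+2)·S₁ + C(k+2, 2)·S₂ + (Σ_{3≤j<k} C(k+2, j)/C(j, 2))·T`** for `k ≥ 3`. -/
lemma rhat_le_uniform (k m : ℕ) (hk : 3 ≤ k) :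
    rhat (m + 2) k m
      ≤ ((k : ℚ) + 2) * ∑ a ∈ range (m + 1), (m.choose a : ℚ) / ((m + 1 + 1 + 1 + a).choose (a + 1) : ℚ)
        + ((k + 2).choose 2 : ℚ) * ∑ a ∈ range (m + 1), (m.choose a : ℚ) / ((m + 2 + 2 + a).choose (a + 2) : ℚ)
        + (∑ u ∈ Finset.range (k - 3), ((k + 2).choose (u + 3) : ℚ) / ((u + 3).choose 2 : ℚ))
          * ∑ a ∈ range (m + 1), (m.choose a : ℚ) / ((m + 2 + a).choose (a + 2) : ℚ) := by
  unfold rhat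
  rw [sum_Ioo_nat, show k - (0 + 1) = (k - 3) + 1 + 1 by omega, Finset.sum_range_succ', Finset.sum_range_succ']
  simp only [zero_add, add_zero, show m + 2 + k - m = k + 2 by omega]
  have hm1 : ∀ a, mhat (m + 2) m a 1 = (m + 1 + 1 + 1 + a).choose (a + 1) := fun a => by
    rw [show m + 2 = m + 1 + 1 by ring]; exact mhat_two m 1 a
  have hm2 : ∀ a, mhat (m + 2) m a 2 = (m + 2 + 2 + a).choose (a + 2) := fun a => by
    have h := mhat_three' m 0 a
    rw [show m + 0 + 2 = m + 2 by ring, show m + 0 + 2 + 2 + a = m + 2 + 2 + a by ring] at h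
    exact h
  simp only [show (1 : ℕ) + 1 = 2 by rfl, hm1, hm2, Nat.choose_one_right]
  push_cast
  have hrw1 : ∑ a ∈ range (m + 1), (m.choose a : ℚ) * ((k : ℚ) + 2) / ((m + 1 + 1 + 1 + a).choose (a + 1) : ℚ)
      = ((k : ℚ) + 2) * ∑ a ∈ range (m + 1), (m.choose a : ℚ) / ((m + 1 + 1 + 1 + a).choose (a + 1) : ℚ) := by
    rw [Finset.mul_sum]; exact Finset.sum_congr rfl (fun a _ => by ring)
  have hrw2 : ∑ a ∈ range (m + 1), (m.choose a : ℚ) * ((k + 2).choose 2 : ℚ) / ((m + 2 + 2 + a).choose (a + 2) : ℚ)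
      = ((k + 2).choose 2 : ℚ) * ∑ a ∈ range (m + 1), (m.choose a : ℚ) / ((m + 2 + 2 + a).choose (a + 2) : ℚ) := by
    rw [Finset.mul_sum]; exact Finset.sum_congr rfl (fun a _ => by ring)
  have h3 : ∑ u ∈ Finset.range (k - 3), ∑ a ∈ range (m + 1),
        (m.choose a : ℚ) * ((k + 2).choose (1 + (u + 1 + 1)) : ℚ) / (mhat (m + 2) m a (1 + (u + 1 + 1)) : ℚ)
      ≤ (∑ u ∈ Finset.range (k - 3), ((k + 2).choose (u + 3) : ℚ) / ((u + 3).choose 2 : ℚ))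
          * ∑ a ∈ range (m + 1), (m.choose a : ℚ) / ((m + 2 + a).choose (a + 2) : ℚ) := by
    rw [Finset.sum_mul]
    apply Finset.sum_le_sum
    intro u _
    rw [Finset.mul_sum]
    apply Finset.sum_le_sum
    intro a _
    have hb := mhat_ge_choose_two m a (u + 3) (by omega)
    have hpos : (0 : ℚ) < (m + 2 + a).choose (a + 2) := by exact_mod_cast Nat.choose_pos (by omega)
    have hc2 : (0 : ℚ) < (u + 3).choose 2 := by exact_mod_cast Nat.choose_pos (by omega)
    have hb' : ((u + 3).choose 2 : ℚ) * ((m + 2 + a).choose (a + 2) : ℚ) ≤ (mhat (m + 2) m a (u + 3) : ℚ) := by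
      exact_mod_cast hb
    rw [show 1 + (u + 1 + 1) = u + 3 by ring]
    rw [show ((k + 2).choose (u + 3) : ℚ) / ((u + 3).choose 2 : ℚ) * ((m.choose a : ℚ) / ((m + 2 + a).choose (a + 2) : ℚ))
        = (m.choose a : ℚ) * ((k + 2).choose (u + 3) : ℚ) / (((u + 3).choose 2 : ℚ) * ((m + 2 + a).choose (a + 2) : ℚ)) by
          field_simp]
    exact div_le_div_of_nonneg_left (by positivity) (by positivity) hb'
  rw [hrw1, hrw2]
  linarith [h3]

/-! ### §3 The slice sums through the half rows, and the finish -/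

/-- `ρ = P/C` on the slice `u = 2` in terms of `X = 4^m/C(2m, m)` (the half row of `2m + 2`). -/
lemma slice_two_rho_eq (m : ℕ) (hm : 1 ≤ m) :
    (∑ i ∈ range m, ((m + 1 + 1 + m).choose i : ℚ)) / ((m + 1 + 1 + m).choose m : ℚ)
      = ((4 : ℚ) ^ m / ((2 * m).choose m : ℚ)) * ((m : ℚ) + 2) / (2 * (m : ℚ) + 1) - 1
        - ((m : ℚ) + 2) / (2 * ((m : ℚ) + 1)) := by
  set C := ((m + 1 + 1 + m).choose m : ℚ) with hC
  set C0 := ((2 * m).choose m : ℚ) with hC0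
  set X := (4 : ℚ) ^ m / C0 with hXdef
  have hCpos : (0 : ℚ) < C := by rw [hC]; exact_mod_cast Nat.choose_pos (by omega)
  have hC0pos : (0 : ℚ) < C0 := by rw [hC0]; exact_mod_cast Nat.choose_pos (by omega)
  obtain ⟨r1, r2⟩ := choose_row_two_ratios m
  have hhalf := sum_range_choose_half_two m
  have hB : ((2 * m + 2).choose (m + 1) : ℚ) * (m + 1) = C * (m + 2) := by
    rw [hC, show m + 1 + 1 + m = 2 * m + 2 by ring]; exact_mod_cast r1
  have h2 : ((2 * m + 2).choose (m + 2) : ℚ) = C := by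
    rw [hC, show m + 1 + 1 + m = 2 * m + 2 by ring]; exact_mod_cast r2
  have h0 : ((2 * m + 2).choose m : ℚ) = C := by rw [hC, show m + 1 + 1 + m = 2 * m + 2 by ring]
  have hh : ((2 * ∑ i ∈ range m, (2 * m + 2).choose i + (2 * m + 2).choose m + (2 * m + 2).choose (m + 1)
      + (2 * m + 2).choose (m + 2) : ℕ) : ℚ) = ((4 ^ (m + 1) : ℕ) : ℚ) := by rw [hhalf]
  push_cast at hh
  rw [h0, h2] at hh
  have hPP : ∑ i ∈ range m, ((m + 1 + 1 + m).choose i : ℚ) = ∑ i ∈ range m, ((2 * m + 2).choose i : ℚ) := by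
    rw [show m + 1 + 1 + m = 2 * m + 2 by ring]
  have hCC0 : C * ((m : ℚ) + 2) * ((m : ℚ) + 1) = C0 * (2 * (m : ℚ) + 1) * (2 * (m : ℚ) + 2) := by
    have ha := Nat.choose_mul_succ_eq (2 * m) m
    rw [show 2 * m + 1 - m = m + 1 by omega] at ha
    have hb' := Nat.choose_mul_succ_eq (2 * m + 1) m
    rw [show 2 * m + 1 + 1 - m = m + 2 by omega, show 2 * m + 1 + 1 = 2 * m + 2 by ring] at hb'
    have ha' : C0 * (2 * (m : ℚ) + 1) = ((2 * m + 1).choose m : ℚ) * (m + 1) := by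
      rw [hC0]; exact_mod_cast ha
    have hb'' : ((2 * m + 1).choose m : ℚ) * (2 * m + 2) = C * (m + 2) := by
      rw [hC, show m + 1 + 1 + m = 2 * m + 2 by ring]; exact_mod_cast hb'
    nlinarith [ha', hb'']
  have hX : (4 : ℚ) ^ m = X * C0 := by rw [hXdef]; field_simp
  rw [hPP, div_eq_iff hCpos.ne']
  have hB' : ((2 * m + 2).choose (m + 1) : ℚ) = C * (m + 2) / (m + 1) := by
    rw [eq_div_iff (by positivity)]; exact hB
  rw [hB'] at hh
  have hC' : C = C0 * (2 * (m : ℚ) + 1) * (2 * (m : ℚ) + 2) / (((m : ℚ) + 2) * ((m : ℚ) + 1)) := by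
    rw [eq_div_iff (by positivity)]; linear_combination hCC0
  have hsum : ∑ i ∈ range m, ((2 * m + 2).choose i : ℚ)
      = ((4 : ℚ) ^ (m + 1) - C - C * (m + 2) / (m + 1) - C) / 2 := by linarith [hh]
  rw [hsum, pow_succ, hX, hC']
  field_simp
  ring

/-- **The finish**, pure `ℚ`: with `E = 2^{k+2}`, `(k+2)(k+1) ≤ E`, `128 ≤ E`, `4E² ≤ m`, `0 ≤ X`, `X·E ≤ m`:
`(k+2)/2 + (((k+2)(k+1)/2)(1+2X) + (E/3)(2+X))/(4m) < k − 1`. -/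
lemma uniform_finish (k m X E : ℚ) (hk : 5 ≤ k) (hE : (k + 2) * (k + 1) ≤ E) (hE1 : 128 ≤ E) (hm : 4 * E ^ 2 ≤ m)
    (hX0 : 0 ≤ X) (hXE : X * E ≤ m) :
    (k + 2) / 2 + (((k + 2) * (k + 1) / 2) * (1 + 2 * X) + (E / 3) * (2 + X)) / (4 * m) < k - 1 := by
  have hmpos : 0 < m := by nlinarith
  have hEpos : 0 < E := by linarith
  -- the numerator is ≤ (E/2)(1 + 2m/E) + (E/3)(2 + m/E) = E/2 + m + 2E/3 + m/3 ≤ m·(4/3) + 7E/6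
  have hnum : ((k + 2) * (k + 1) / 2) * (1 + 2 * X) + (E / 3) * (2 + X) ≤ E / 2 + m + 2 * E / 3 + m / 3 := by
    have h1 : ((k + 2) * (k + 1) / 2) * (1 + 2 * X) ≤ (E / 2) * (1 + 2 * X) := by
      apply mul_le_mul_of_nonneg_right _ (by linarith)
      linarith
    have h2 : (E / 2) * (1 + 2 * X) = E / 2 + E * X := by ring
    have h3 : (E / 3) * (2 + X) = 2 * E / 3 + E * X / 3 := by ring
    have h4 : E * X ≤ m := by linarith [hXE]
    nlinarith [h1, h2, h3, h4]
  have hfrac : (((k + 2) * (k + 1) / 2) * (1 + 2 * X) + (E / 3) * (2 + X)) / (4 * m)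
      ≤ (E / 2 + m + 2 * E / 3 + m / 3) / (4 * m) := by
    apply div_le_div_of_nonneg_right hnum (by positivity)
  have hsmall : (E / 2 + m + 2 * E / 3 + m / 3) / (4 * m) < 1 / 2 := by
    rw [div_lt_iff₀ (by positivity)]
    -- E/2 + 2E/3 = 7E/6 ≤ 7m/(6·4E) ... use 4E² ≤ m ⇒ E ≤ m/(4E) ≤ m/512
    have hEm : 512 * E ≤ m := by nlinarith [hE1, hm, hEpos]
    nlinarith [hEm, hmpos]
  linarith [hfrac, hsmall]

/-- `(k + 2)(k + 1) ≤ 2^{k+2}` for `k ≥ 5` (induction from `42 ≤ 128`). -/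
lemma succ_mul_succ_le_two_pow : ∀ k : ℕ, 5 ≤ k → (k + 2) * (k + 1) ≤ 2 ^ (k + 2) := by
  intro k
  induction k with
  | zero => intro h; omega
  | succ k ih =>
    intro hk
    rcases Nat.lt_or_ge k 5 with hlt | hge
    · interval_cases k <;> omega
    · have := ih hge
      calc (k + 1 + 2) * (k + 1 + 1) ≤ 2 * ((k + 2) * (k + 1)) := by nlinarith
        _ ≤ 2 * 2 ^ (k + 2) := by omega
        _ = 2 ^ (k + 1 + 2) := by ring

set_option maxHeartbeats 400000 in
/-- **Rule Q fails on every cell family `k ≥ 5`**: `¬ RhatCell q k` for every `k ≥ 5` and every `q ≥ 4^{k+3} + 2` (the member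
slice `u = 2`). With `rhatCell_two`, `rhatCell_three`, `rhatCell_four` (p4): (R̂) holds on every cell of the family `k` if and
only if `k ≤ 4`. -/
theorem not_rhatCell_of_five_le (k : ℕ) (hk : 5 ≤ k) (q : ℕ) (hq : 4 ^ (k + 3) + 2 ≤ q) : ¬ RhatCell q k := by
  intro h
  have h4 : 0 < 4 ^ (k + 3) := by positivity
  obtain ⟨m, rfl⟩ : ∃ m, q = m + 2 := ⟨q - 2, by omega⟩
  have hm1 : 1 ≤ m := by omega
  have hmem := h m (by omega)
  have hphi := phiK_ge_sub_one (m + 2) k (by omega)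
  have hup := rhat_le_uniform k m (by omega)
  rw [cellTwo_sum_eq m 1, slice_two_S2_eq m hm1, slice_T_eq m hm1] at hup
  push_cast at hup
  -- closed forms: S₁ = ((m+1) − ρ)/(2m+3), S₂ = (1 + 2ρ)/(2(2m+3)), ρ = X(m+2)/(2m+1) − 1 − (m+2)/(2(m+1))
  set C := ((m + 1 + 1 + m).choose m : ℚ) with hC
  set P := ∑ i ∈ range m, ((m + 1 + 1 + m).choose i : ℚ) with hPdef
  set C0 := ((2 * m).choose m : ℚ) with hC0
  set X := (4 : ℚ) ^ m / C0 with hXdef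
  have hCpos : (0 : ℚ) < C := by rw [hC]; exact_mod_cast Nat.choose_pos (by omega)
  have hC0pos : (0 : ℚ) < C0 := by rw [hC0]; exact_mod_cast Nat.choose_pos (by omega)
  have hX0 : (0 : ℚ) ≤ X := by positivity
  have hrho : P / C = X * ((m : ℚ) + 2) / (2 * (m : ℚ) + 1) - 1 - ((m : ℚ) + 2) / (2 * ((m : ℚ) + 1)) :=
    slice_two_rho_eq m hm1
  have e1 : (((m : ℚ) + 1) * C - 1 * P) / (C * ((m : ℚ) + 1 + 1 + m + 1))
      = (((m : ℚ) + 1) - P / C) / (2 * (m : ℚ) + 3) := by field_simp; ring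
  have e2 : (C + 2 * P) / (2 * C * (2 * (m : ℚ) + 3)) = (1 + 2 * (P / C)) / (2 * (2 * (m : ℚ) + 3)) := by
    field_simp
  rw [e1, e2, hrho] at hup
  -- the three elementary bounds
  have hS1 : (((m : ℚ) + 1) - (X * ((m : ℚ) + 2) / (2 * (m : ℚ) + 1) - 1 - ((m : ℚ) + 2) / (2 * ((m : ℚ) + 1))))
      / (2 * (m : ℚ) + 3) ≤ 1 / 2 := by
    rw [div_le_iff₀ (by positivity)]
    have hrho0 : (0 : ℚ) ≤ X * ((m : ℚ) + 2) / (2 * (m : ℚ) + 1) - 1 - ((m : ℚ) + 2) / (2 * ((m : ℚ) + 1)) := by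
      rw [← hrho]; positivity
    linarith [hrho0]
  have hS2 : (1 + 2 * (X * ((m : ℚ) + 2) / (2 * (m : ℚ) + 1) - 1 - ((m : ℚ) + 2) / (2 * ((m : ℚ) + 1))))
      / (2 * (2 * (m : ℚ) + 3)) ≤ (1 + 2 * X) / (4 * (m : ℚ)) := by
    have hr : X * ((m : ℚ) + 2) / (2 * (m : ℚ) + 1) - 1 - ((m : ℚ) + 2) / (2 * ((m : ℚ) + 1)) ≤ X := by
      have : X * ((m : ℚ) + 2) / (2 * (m : ℚ) + 1) ≤ X := by
        rw [div_le_iff₀ (by positivity)]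
        have hm1' : (1 : ℚ) ≤ m := by exact_mod_cast hm1
        nlinarith [hX0, hm1']
      have : (0 : ℚ) ≤ 1 + ((m : ℚ) + 2) / (2 * ((m : ℚ) + 1)) := by positivity
      linarith
    rw [div_le_div_iff₀ (by positivity) (by positivity)]
    nlinarith [hr, hX0]
  have hT : 1 / (2 * (m : ℚ) + 2) + X / (2 * (2 * (m : ℚ) + 1)) ≤ (2 + X) / (4 * (m : ℚ)) := by
    have hm1' : (1 : ℚ) ≤ m := by exact_mod_cast hm1
    have ha : 1 / (2 * (m : ℚ) + 2) ≤ 2 / (4 * (m : ℚ)) := by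
      rw [div_le_div_iff₀ (by positivity) (by positivity)]; nlinarith
    have hb : X / (2 * (2 * (m : ℚ) + 1)) ≤ X / (4 * (m : ℚ)) := by
      apply div_le_div_of_nonneg_left hX0 (by positivity) (by linarith)
    calc 1 / (2 * (m : ℚ) + 2) + X / (2 * (2 * (m : ℚ) + 1)) ≤ 2 / (4 * (m : ℚ)) + X / (4 * (m : ℚ)) := add_le_add ha hb
      _ = (2 + X) / (4 * (m : ℚ)) := by ring
  -- the coefficients and the Wallis bound
  have hcoef := sum_choose_div_choose_two_le k (by omega)
  have hc2 : ((k + 2).choose 2 : ℚ) = ((k : ℚ) + 2) * ((k : ℚ) + 1) / 2 := by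
    obtain ⟨c2, -, -, -⟩ := choose_small_values k
    rw [eq_div_iff (by norm_num)]; exact c2
  have hW := centralBinom_sq_mul_ge m (by omega)
  rw [Nat.centralBinom_eq_two_mul_choose] at hW
  have hX2 : X ^ 2 ≤ 4 * (m : ℚ) := by
    have h16 : (16 : ℚ) ^ m = ((4 : ℚ) ^ m) ^ 2 := by rw [← pow_mul, mul_comm, pow_mul]; norm_num
    have h' : ((16 ^ m : ℕ) : ℚ) ≤ (((2 * m).choose m ^ 2 * (4 * m) : ℕ) : ℚ) := by exact_mod_cast hW
    push_cast at h'
    have hX : (4 : ℚ) ^ m = X * C0 := by rw [hXdef]; field_simp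
    rw [h16, hX] at h'
    have : (X * C0) ^ 2 = X ^ 2 * C0 ^ 2 := by ring
    rw [this] at h'
    have hC0sq : (0 : ℚ) < C0 ^ 2 := by positivity
    nlinarith [h', hC0sq]
  -- E = 2^{k+2}: (k+2)(k+1) ≤ E, 128 ≤ E, 4E² ≤ m, X·E ≤ m
  set E : ℚ := (2 : ℚ) ^ (k + 2) with hE
  have hE1 : (128 : ℚ) ≤ E := by
    rw [hE]
    calc (128 : ℚ) = 2 ^ 7 := by norm_num
      _ ≤ 2 ^ (k + 2) := pow_le_pow_right₀ (by norm_num) (by omega)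
  have hEk : ((k : ℚ) + 2) * ((k : ℚ) + 1) ≤ E := by
    rw [hE]; exact_mod_cast succ_mul_succ_le_two_pow k hk
  have hmE : 4 * E ^ 2 ≤ (m : ℚ) := by
    have : (4 : ℚ) ^ (k + 3) ≤ m := by exact_mod_cast (show 4 ^ (k + 3) ≤ m by omega)
    rw [hE]
    have h44 : (4 : ℚ) ^ (k + 3) = 4 * ((2 : ℚ) ^ (k + 2)) ^ 2 := by
      have h4 : (4 : ℚ) = 2 ^ 2 := by norm_num
      rw [h4, ← pow_mul, ← pow_mul]
      ring
    rw [← h44]; exact this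
  have hXE : X * E ≤ m := by
    -- X² ≤ 4m and 4E² ≤ m ⇒ (XE)² ≤ 4m·E² ≤ m²
    have h1 : (X * E) ^ 2 ≤ (m : ℚ) ^ 2 := by
      calc (X * E) ^ 2 = X ^ 2 * E ^ 2 := by ring
        _ ≤ 4 * (m : ℚ) * E ^ 2 := by gcongr
        _ = (m : ℚ) * (4 * E ^ 2) := by ring
        _ ≤ (m : ℚ) * m := by gcongr
        _ = (m : ℚ) ^ 2 := by ring
    have hXE0 : 0 ≤ X * E := by positivity
    exact (pow_le_pow_iff_left₀ hXE0 (by positivity) two_ne_zero).mp h1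
  have hfin := uniform_finish k m X E (by exact_mod_cast hk) hEk hE1 hmE hX0 hXE
  -- assemble: Φ ≤ rhat ≤ (k+2)S₁ + C(k+2,2)S₂ + coef·T ≤ (k+2)/2 + [...]/(4m) < k − 1 ≤ Φ
  have hcoef0 : (0 : ℚ) ≤ ∑ u ∈ Finset.range (k - 3), ((k + 2).choose (u + 3) : ℚ) / ((u + 3).choose 2 : ℚ) := by
    positivity
  have hT0 : (0 : ℚ) ≤ 1 / (2 * (m : ℚ) + 2) + X / (2 * (2 * (m : ℚ) + 1)) := by positivity
  have hbound : ((k : ℚ) + 2) * ((((m : ℚ) + 1) - (X * ((m : ℚ) + 2) / (2 * (m : ℚ) + 1) - 1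
        - ((m : ℚ) + 2) / (2 * ((m : ℚ) + 1)))) / (2 * (m : ℚ) + 3))
      + ((k + 2).choose 2 : ℚ) * ((1 + 2 * (X * ((m : ℚ) + 2) / (2 * (m : ℚ) + 1) - 1
        - ((m : ℚ) + 2) / (2 * ((m : ℚ) + 1)))) / (2 * (2 * (m : ℚ) + 3)))
      + (∑ u ∈ Finset.range (k - 3), ((k + 2).choose (u + 3) : ℚ) / ((u + 3).choose 2 : ℚ))
        * (1 / (2 * (m : ℚ) + 2) + X / (2 * (2 * (m : ℚ) + 1)))
      ≤ ((k : ℚ) + 2) / 2 + ((((k : ℚ) + 2) * ((k : ℚ) + 1) / 2) * (1 + 2 * X) + (E / 3) * (2 + X)) / (4 * (m : ℚ)) := by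
    have hk0 : (0 : ℚ) ≤ (k : ℚ) + 2 := by positivity
    have hc0 : (0 : ℚ) ≤ ((k + 2).choose 2 : ℚ) := by positivity
    have t1 := mul_le_mul_of_nonneg_left hS1 hk0
    have t2 := mul_le_mul_of_nonneg_left hS2 hc0
    have t3 : (∑ u ∈ Finset.range (k - 3), ((k + 2).choose (u + 3) : ℚ) / ((u + 3).choose 2 : ℚ))
        * (1 / (2 * (m : ℚ) + 2) + X / (2 * (2 * (m : ℚ) + 1))) ≤ (E / 3) * ((2 + X) / (4 * (m : ℚ))) := by
      have hE3 : (∑ u ∈ Finset.range (k - 3), ((k + 2).choose (u + 3) : ℚ) / ((u + 3).choose 2 : ℚ)) ≤ E / 3 := by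
        rw [hE]; exact hcoef
      calc _ ≤ (∑ u ∈ Finset.range (k - 3), ((k + 2).choose (u + 3) : ℚ) / ((u + 3).choose 2 : ℚ))
            * ((2 + X) / (4 * (m : ℚ))) := mul_le_mul_of_nonneg_left hT hcoef0
        _ ≤ (E / 3) * ((2 + X) / (4 * (m : ℚ))) := mul_le_mul_of_nonneg_right hE3 (by positivity)
    rw [hc2] at t2 ⊢
    have : ((k : ℚ) + 2) * (1 / 2) + ((k : ℚ) + 2) * ((k : ℚ) + 1) / 2 * ((1 + 2 * X) / (4 * (m : ℚ)))
        + (E / 3) * ((2 + X) / (4 * (m : ℚ)))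
        = ((k : ℚ) + 2) / 2 + ((((k : ℚ) + 2) * ((k : ℚ) + 1) / 2) * (1 + 2 * X) + (E / 3) * (2 + X)) / (4 * (m : ℚ)) := by
      field_simp
      ring
    linarith [t1, t2, t3, this]
  linarith [hmem, hphi, hup, hbound, hfin]

end PercRepro
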